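/-
COR-CM (cell pub-hodgecm2, stage 2 of the Hodge ladder) — count-neutral KERNEL COMBINATORICS «the binary tetrahedral group SL(2,3)», part XIV: THE LAW
(seat prover-pub-hodgecm2-b23-g53-0, binder prover b23, gen 53; claim HOME/INBOX.md l.24246, NAME ASK l.24300).  Theorems only, on parts I–XIII and this
seatʼs `Census/SylowTransfer*` BY NAME; no `decide`, no certificate, no named fact, no `sorry`.  `Interfaces.lean` (C1), every E term, B01, `Transposition/*`,
`PortJoin/*`, `D2Bridge/*` untouched.
HONEST FRAMING: `HC_CM` is NOT proved, here or anywhere in the tree; nothing here is a period, a count of record or a headline.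
T5: n/a-class (hypothesis binders = the fields of `BinaryTetrahedral.Datum` / the order of the group); checker: self.
-/
import Summits.HodgeConjecture.CorCM.Census.BinaryTetrahedralTransport
import Summits.HodgeConjecture.CorCM.Census.BinaryTetrahedralBlockCount
import Summits.HodgeConjecture.CorCM.Census.BinaryTetrahedralDichotomy

/-!
# The binary tetrahedral group, XIV: THE LAW `μ(SL(2,3), −1) = φ₂ = β − 2`, and EVERY group of order `8p`

* §1 **THE BINARY TETRAHEDRAL LAW** (`isLeast_card_gfaces_generate_fibreTwo`; the row `μ = 174`, `β = 176` with part XV): for every binary tetrahedral datum `D : Datum G c` (`G ≅ SL(2,3)`,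
  `c = −1`) the least number of faces whose base changes generate the Hodge span of `(G, c)` modulo pairs is EXACTLY `φ₂(G, c) = β(G, c) − 2`:
  the floor is part II; the family is part Xʼs (one reducing face per non-residual block of the model and the eight closing faces, `≤ β − 2` members)
  transported by part XIII.
* §2 **EVERY GROUP OF ORDER `24` AND EVERY CENTRAL INVOLUTION: `μ = φ₂`** (`isLeast_card_gfaces_generate_fibreTwo_of_card_eq_twentyfour`, part IIIbʼs
  dichotomy + §1), hence **EVERY GROUP OF ORDER `8p`, `p` ANY ODD PRIME** (`…_of_card_eq_eight_mul_prime`, with part XIV of the Sylow-transfer lane for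
  `p ≥ 5`) — the order-`8p` column of the census is COMPLETE, with no hypothesis on the group or on the involution.
All [folklore] bookkeeping over [Pohlmann1968, Thm 1] in the reading of [Milne1999, Prop. 2.1].

## References
* [Pohlmann1968] H. Pohlmann, Algebraic cycles on abelian varieties of complex multiplication type, Ann. of Math. 88 (1968), Thm 1.
* [Milne1999] J. S. Milne, Lefschetz motives and the Tate conjecture, Compositio Math. 117 (1999), Prop. 2.1, p. 54.
-/

namespace Summit.HodgeConjecture.CorCM.Census.BinaryTetrahedral

open Finset
open Summit.HodgeConjecture.CorCM.Prior.AllgGroup.RfwfAllgGroup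
open Summit.HodgeConjecture.CorCM.Census.BlockParity
open Summit.HodgeConjecture.CorCM.Census.Coinvariant
open Summit.HodgeConjecture.CorCM.Census.QuarticInversion (hodge₄ pairs₄)

noncomputable section

variable {G : Type*} [Group G] [Fintype G] [DecidableEq G] {c : G}

/-! ## §1 The binary tetrahedral law -/

/-- **A generating family of at most `φ₂(G, c)` faces exists** along every binary tetrahedral datum: part Xʼs family, transported. [folklore] -/
theorem exists_gfaces_generate_le (D : Datum G c) : ∃ S : Finset (CMF G c →₀ ℤ), ↑S ⊆ gfaceSet G c D.c_mul_c ∧ S.card ≤ fibreTwo c D.c_mul_c ∧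
    hodgeSpan c D.c_mul_c ≤ Submodule.span ℤ (pairSet c) ⊔ Submodule.span ℤ (translates c S) := by
  refine ⟨genFamily.image (gfOf D), image_gfOf_subset_gfaceSet D (fun f hf => genFamily_shape hf), ?_,
    hodgeSpan_le_of_family D (fun f hf => genFamily_shape hf) hodge₄_le⟩
  have h1 := card_genFamily_add_two_le
  have h2 := card_block_eq D
  have h3 := D.card_block_eq_fibreTwo_add_two
  exact Finset.card_image_le.trans (by omega)

/-- **THE BINARY TETRAHEDRAL LAW: `μ(G, c) = φ₂(G, c)` for every binary tetrahedral datum** (`G ≅ SL(2,3)`, `c = −1`). [folklore] -/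
theorem isLeast_card_gfaces_generate_fibreTwo (D : Datum G c) :
    IsLeast {m : ℕ | ∃ S : Finset (CMF G c →₀ ℤ), (↑S ⊆ gfaceSet G c D.c_mul_c) ∧ S.card = m ∧
      hodgeSpan c D.c_mul_c ≤ Submodule.span ℤ (pairSet c) ⊔ Submodule.span ℤ (translates c S)} (fibreTwo c D.c_mul_c) :=
  D.isLeast_of_exists_le (exists_gfaces_generate_le D)

/-- **The law in block currency: `μ(G, c) = β(G, c) − 2`** for every binary tetrahedral datum. [folklore] -/
theorem isLeast_card_gfaces_generate_card_block_sub_two (D : Datum G c) :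
    IsLeast {m : ℕ | ∃ S : Finset (CMF G c →₀ ℤ), (↑S ⊆ gfaceSet G c D.c_mul_c) ∧ S.card = m ∧
      hodgeSpan c D.c_mul_c ≤ Submodule.span ℤ (pairSet c) ⊔ Submodule.span ℤ (translates c S)} (Fintype.card (BlockParity.Block c) - 2) := by
  rw [D.card_block_eq_fibreTwo_add_two, Nat.add_sub_cancel]
  exact isLeast_card_gfaces_generate_fibreTwo D

/-- **THE ROW `SL(2,3)`: `μ = 174`** (`β = 176`, `φ₂ = 174`, part XV). [folklore] -/
theorem isLeast_card_gfaces_generate_oneHundredSeventyFour (D : Datum G c) :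
    IsLeast {m : ℕ | ∃ S : Finset (CMF G c →₀ ℤ), (↑S ⊆ gfaceSet G c D.c_mul_c) ∧ S.card = m ∧
      hodgeSpan c D.c_mul_c ≤ Submodule.span ℤ (pairSet c) ⊔ Submodule.span ℤ (translates c S)} 174 := by
  rw [← D.fibreTwo_eq_oneHundredSeventyFour]
  exact isLeast_card_gfaces_generate_fibreTwo D

/-! ## §2 Every group of order `24`, every group of order `8p` -/

/-- **EVERY GROUP OF ORDER `24` AND EVERY CENTRAL INVOLUTION `c ≠ 1`: `μ(G, c) = φ₂(G, c)`** — no hypothesis on the group. [folklore] -/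
theorem isLeast_card_gfaces_generate_fibreTwo_of_card_eq_twentyfour (c : G) (hG : Fintype.card G = 24)
    (hc2 : c * c = 1) (hc1 : c ≠ 1) (hcen : ∀ w : G, w * c = c * w) :
    IsLeast {m : ℕ | ∃ S : Finset (CMF G c →₀ ℤ), (↑S ⊆ gfaceSet G c hc2) ∧ S.card = m ∧
      hodgeSpan c hc2 ≤ Submodule.span ℤ (pairSet c) ⊔ Submodule.span ℤ (translates c S)} (fibreTwo c hc2) := by
  rcases isLeast_or_nonempty_datum_of_card_eq_twentyfour c hG hc2 hc1 hcen with h | hD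
  · exact h
  · obtain ⟨D⟩ := hD
    exact isLeast_card_gfaces_generate_fibreTwo D

/-- **EVERY GROUP OF ORDER `8p` (`p` ANY ODD PRIME) AND EVERY CENTRAL INVOLUTION `c ≠ 1`: `μ(G, c) = φ₂(G, c)`** — the order-`8p` column of the census
is complete (part XIV of the Sylow-transfer lane for `p ≥ 5`, the binary tetrahedral law for the last row `SL(2,3)`). [folklore] -/
theorem isLeast_card_gfaces_generate_fibreTwo_of_card_eq_eight_mul_prime (c : G) {p : ℕ} (hp : p.Prime) (hp2 : p ≠ 2)
    (hG : Fintype.card G = 8 * p) (hc2 : c * c = 1) (hc1 : c ≠ 1) (hcen : ∀ w : G, w * c = c * w) :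
    IsLeast {m : ℕ | ∃ S : Finset (CMF G c →₀ ℤ), (↑S ⊆ gfaceSet G c hc2) ∧ S.card = m ∧
      hodgeSpan c hc2 ≤ Submodule.span ℤ (pairSet c) ⊔ Submodule.span ℤ (translates c S)} (fibreTwo c hc2) := by
  rcases isLeast_or_nonempty_datum_of_card_eq_eight_mul_prime c hp hp2 hG hc2 hc1 hcen with h | ⟨-, hD⟩
  · exact h
  · obtain ⟨D⟩ := hD
    exact isLeast_card_gfaces_generate_fibreTwo D

end

end Summit.HodgeConjecture.CorCM.Census.BinaryTetrahedral
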